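import Mathlib.Analysis.Normed.Group.Constructions
import Literature.Probability.LatticeModels.TorusCentredLift
import HarnessLib

/-!
# Time separation of centred representatives on the odd torus

Topic `Literature/Probability/LatticeModels`; namespace `Literature.Probability.LatticeModels`.
Companion to `TorusCentredLift.lean` (centred lift `Torus.cRep`, `Torus.cRepZ` of the discrete
torus).

On the ODD torus `(ℤ/(2S+1)ℤ)^d` the centred lift lands in the box `Λ_S = {-S,…,S}^d`
(`Torus.abs_cRepZ_le_half`, `Torus.cRep_mem_box_half`), and centring cannot destroy a time
separation: if an integer `z` has `n - D ≤ |z| ≤ n + D` with `n ≤ S`, then its centred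
representative modulo `2S+1` still has absolute value `≥ n - D`
(`Torus.sub_le_abs_cRepZ_of_window`) — a wrap-around moves `|z|` to at least
`2S + 1 - (n + D) ≥ (n - D) + (2S + 1 - 2n) > n - D`.

Consequences for two boxes at time distance `n` inside the torus of side `2S+1` (the geometry of
two-box correlation / clustering statements, e.g. Friedli–Velenik §3.1, periodic boundary
conditions): for `u ∈ Λ_R`, `u' ∈ Λ_{R'}` and `n ≤ S` there is a lattice vector `v ∈ Λ_S` with
sup norm `‖v‖ ≥ n - R - R'` and `proj (u' + n e_{i₀}) = proj u + proj v`
(`Torus.exists_box_shift_eq_add_proj`), and symmetrically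
`proj u = proj (u' + n e_{i₀}) + proj v` (`Torus.exists_box_eq_shift_add_proj`).  Here `‖v‖` is
Mathlib's sup norm of `v : Fin d → ℤ`.

Everything is proved; no definitions are introduced.

## References

* S. Friedli, Y. Velenik, *Statistical Mechanics of Lattice Systems* (CUP 2017), §3.1.
  [FriedliVelenik2017]
-/

noncomputable section

namespace Literature.Probability.LatticeModels

open Finset

variable {d : ℕ}

/-- On the odd torus of side `2S+1` the centred representative has absolute value at most `S`.
[folklore] -/
theorem Torus.abs_cRepZ_le_half {S : ℕ} (a : ZMod (2 * S + 1)) : |Torus.cRepZ a| ≤ S := by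
  have h := Torus.two_mul_natAbs_cRepZ_le a
  rw [Int.abs_eq_natAbs]
  omega

/-- On the odd torus of side `2S+1` the centred lift lands in the box `Λ_S = {-S,…,S}^d`.
[folklore] -/
theorem Torus.cRep_mem_box_half {S : ℕ} (u : TorusSite d (2 * S + 1)) : Torus.cRep u ∈ box d S := by
  rw [mem_box]
  intro i
  exact abs_le.1 (Torus.abs_cRepZ_le_half (u i))

/-- **Centring preserves a time separation.** If `n ≤ S` and the integer `z` satisfies
`n - D ≤ |z| ≤ n + D`, then the centred representative of `z` modulo `2S+1` satisfies
`n - D ≤ |cRepZ z|`: either it equals `z`, or it differs from `z` by at least `2S+1` and then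
`|cRepZ z| ≥ 2S + 1 - |z| ≥ 2S + 1 - n - D ≥ n - D`. [folklore] -/
theorem Torus.sub_le_abs_cRepZ_of_window {S n : ℕ} {D : ℤ} (z : ℤ) (hn : n ≤ S)
    (h1 : (n : ℤ) - D ≤ |z|) (h2 : |z| ≤ n + D) :
    (n : ℤ) - D ≤ |Torus.cRepZ (z : ZMod (2 * S + 1))| := by
  rcases Torus.sub_repr_dichotomy (L := 2 * S + 1) (z := Torus.cRepZ (z : ZMod (2 * S + 1))) (w := z)
    (Torus.intCast_cRepZ _) with h | h
  · rw [h]; exact h1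
  · have h3 : |Torus.cRepZ (z : ZMod (2 * S + 1)) - z| ≤ |Torus.cRepZ (z : ZMod (2 * S + 1))| + |z| :=
      abs_sub _ _
    have h4 : ((2 * S + 1 : ℕ) : ℤ) = 2 * (S : ℤ) + 1 := by push_cast; ring
    rw [h4] at h
    have h5 : (n : ℤ) ≤ S := by exact_mod_cast hn
    linarith

/-- Real-norm form: for `w : ℤ^d` whose coordinate `i` satisfies `n - D ≤ |w i| ≤ n + D` with
`n ≤ S`, the centred lift of `proj w` on the torus of side `2S+1` has sup norm `≥ n - D`.
[folklore] -/
theorem Torus.sub_le_norm_cRep_proj_of_window {S n : ℕ} {D : ℤ} (w : Site d) (i : Fin d) (hn : n ≤ S)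
    (h1 : (n : ℤ) - D ≤ |w i|) (h2 : |w i| ≤ n + D) :
    (n : ℝ) - D ≤ ‖Torus.cRep (Torus.proj (2 * S + 1) w)‖ := by
  have h := Torus.sub_le_abs_cRepZ_of_window (S := S) (w i) hn h1 h2
  have hi : ‖Torus.cRep (Torus.proj (2 * S + 1) w) i‖ ≤ ‖Torus.cRep (Torus.proj (2 * S + 1) w)‖ :=
    norm_le_pi_norm _ i
  rw [Int.norm_eq_abs] at hi
  have hc : Torus.cRep (Torus.proj (2 * S + 1) w) i = Torus.cRepZ ((w i : ℤ) : ZMod (2 * S + 1)) := rfl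
  rw [hc] at hi
  have h' : ((n : ℤ) - D : ℤ) ≤ (|Torus.cRepZ ((w i : ℤ) : ZMod (2 * S + 1))| : ℤ) := h
  have h'' : ((n : ℝ) - D) ≤ |((Torus.cRepZ ((w i : ℤ) : ZMod (2 * S + 1)) : ℤ) : ℝ)| := by
    rw [← Int.cast_abs]; exact_mod_cast h'
  exact h''.trans hi

/-- **Two boxes at time distance `n` inside the odd torus.** For `u ∈ Λ_R`, `u' ∈ Λ_{R'}` and
`n ≤ S` there is a lattice vector `v ∈ Λ_S` of sup norm `‖v‖ ≥ n - R - R'` with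
`proj (u' + n e_{i₀}) = proj u + proj v` on the torus of side `2S+1` (namely the centred lift of
`proj (u' + n e_{i₀} - u)`). [folklore] -/
theorem Torus.exists_box_shift_eq_add_proj (i₀ : Fin d) {S n R R' : ℕ} (hn : n ≤ S) {u u' : Site d}
    (hu : u ∈ box d R) (hu' : u' ∈ box d R') :
    ∃ v ∈ box d S, (n : ℝ) - (R + R') ≤ ‖v‖ ∧
      Torus.proj (2 * S + 1) (u' + Pi.single i₀ (n : ℤ)) =
        Torus.proj (2 * S + 1) u + Torus.proj (2 * S + 1) v := by
  set w : Site d := u' + Pi.single i₀ (n : ℤ) - u with hw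
  refine ⟨Torus.cRep (Torus.proj (2 * S + 1) w), Torus.cRep_mem_box_half _, ?_, ?_⟩
  · have hwi : w i₀ = u' i₀ + n - u i₀ := by simp [hw]
    rw [mem_box] at hu hu'
    have hn1 : (n : ℤ) - (R + R') ≤ |w i₀| := by
      rw [hwi]; refine le_trans ?_ (le_abs_self _); linarith [(hu i₀).2, (hu' i₀).1]
    have hn2 : |w i₀| ≤ n + (R + R') := by
      rw [hwi, abs_le]; constructor <;> linarith [(hu i₀).1, (hu i₀).2, (hu' i₀).1, (hu' i₀).2]
    have := Torus.sub_le_norm_cRep_proj_of_window (S := S) w i₀ hn hn1 hn2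
    push_cast at this
    exact this
  · rw [Torus.proj_cRep, hw]
    funext i
    simp [Torus.proj]

/-- The symmetric form: for `u ∈ Λ_R`, `u' ∈ Λ_{R'}` and `n ≤ S` there is `v ∈ Λ_S` of sup norm
`‖v‖ ≥ n - R - R'` with `proj u = proj (u' + n e_{i₀}) + proj v` on the torus of side `2S+1`.
[folklore] -/
theorem Torus.exists_box_eq_shift_add_proj (i₀ : Fin d) {S n R R' : ℕ} (hn : n ≤ S) {u u' : Site d}
    (hu : u ∈ box d R) (hu' : u' ∈ box d R') :
    ∃ v ∈ box d S, (n : ℝ) - (R + R') ≤ ‖v‖ ∧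
      Torus.proj (2 * S + 1) u =
        Torus.proj (2 * S + 1) (u' + Pi.single i₀ (n : ℤ)) + Torus.proj (2 * S + 1) v := by
  set w : Site d := u - (u' + Pi.single i₀ (n : ℤ)) with hw
  refine ⟨Torus.cRep (Torus.proj (2 * S + 1) w), Torus.cRep_mem_box_half _, ?_, ?_⟩
  · have hwi : w i₀ = u i₀ - (u' i₀ + n) := by simp [hw]
    rw [mem_box] at hu hu'
    have hn1 : (n : ℤ) - (R + R') ≤ |w i₀| := by
      rw [hwi]; refine le_trans ?_ (neg_le_abs _); linarith [(hu i₀).2, (hu' i₀).1]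
    have hn2 : |w i₀| ≤ n + (R + R') := by
      rw [hwi, abs_le]; constructor <;> linarith [(hu i₀).1, (hu i₀).2, (hu' i₀).1, (hu' i₀).2]
    have := Torus.sub_le_norm_cRep_proj_of_window (S := S) w i₀ hn hn1 hn2
    push_cast at this
    exact this
  · rw [Torus.proj_cRep, hw]
    funext i
    simp [Torus.proj]

end Literature.Probability.LatticeModels

end
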